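import Mathlib.Topology.Algebra.ClopenNhdofOne
import Mathlib.Data.Finite.Perm
import Literature.AnabelianGeometry.Anabelioids.AutOfEquivalence
import Literature.AnabelianGeometry.SemiGraphs.MorphismRigidity
import Literature.AnabelianGeometry.SemiGraphs.QuotientApproximator
import Literature.AnabelianGeometry.SemiGraphs.SurfaceTypeCuspQuotients

/-!
# [SemiAnbd] Example 2.10, conjunct (1): semi-graphs of anabelioids of surface type are coherent

Mochizuki, *Semi-graphs of anabelioids*, Publ. RIMS **42** (2006), Example 2.10 p. 31: the
semi-graph of anabelioids of a pointed stable curve "is coherent, totally elevated, …" ("one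
verifies immediately … from the well-known structure of fundamental groups of hyperbolic Riemann
surfaces of finite type") [cite: MochizukiSemiAnbd2006, Ex. 2.10 p.31].  Conjunct (1) of the named
fact `SemiGraphOfAnabelioids.example_2_10` (abc-iut-L3-t1, `Coverticial.lean`, with the binder
`EveryEdgeAbuts` of ruling σ2: every edge abuts to a vertex — without it (1) fails on a vertexless
edge).  This proof-only file (cell abc-iut, layer L3, row G31 (1), seat abc-iut-L3-t4) PROVES it:

* quasi-coherence (`isQuasiCoherent_of_isOfSurfaceType`): given coverings `U_c ⊆ Π_c` of degree
  `≤ M` of all the constituents, let `n` be the product of the `Σ`-integers `≤ M!` (a `Σ`-integer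
  divisible by the order of every finite `Σ`-group of order `≤ M!`); at each vertex take the uniform
  cusp-order open normal subgroup `W_v ⊆ core(U_v)` of `SurfaceTypeCuspQuotients.lean` (index
  `∣ M!·n³`, meeting every branch group `Π_b` in the closure of its `n`-th powers), at each edge the
  closed normal subgroup `N_e` generated by the `n`-th powers; these are compatible along every branch
  (`Π_e → Π_v` is a closed embedding), so `QuotientApproximator.lean` gives an approximator
  `𝒢 → 𝒢'` splitting the `U_c` (`N_e ⊆ core(U_e)` because `Π_e`, a closed subgroup of the pro-`Σ`
  group `Π_v`, is pro-`Σ`: `isSigmaInteger_index_of_embedding`);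
* coherence (`isCoherent_of_isOfSurfaceType`): plus topological finite generation of the `Π_v`
  (`SurfaceTypeCuspQuotients`) and of the `Π_e ≅ Π_b = (ι⟨c⟩)⁻` (procyclic).
Nothing here takes a side on any disputed claim.
-/

namespace Literature.AnabelianGeometry.SemiGraphs

open CategoryTheory CategoryTheory.Limits CategoryTheory.PreGaloisCategory Topology
open Literature.AnabelianGeometry.Anabelioids
open Literature.GroupTheory.CombinatorialGroupTheory

universe v₁ u₁ u

/-! ### Profinite preliminaries -/

section Prelim

/-- Conjugation by an isomorphism of fibre functors is continuous (coordinatewise on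
`∏_X Aut (F X)`; copy of abc-iut-L3-t12's `continuous_conjAut_of_iso`, kept private to avoid a heavy
import). [folklore] -/
private theorem continuous_conjAut_of_iso' {C : Type*} [Category C] [GaloisCategory C]
    {F F' : C ⥤ FintypeCat.{v₁}} [FiberFunctor F] [FiberFunctor F'] (e : F ≅ F') :
    Continuous e.conjAut := by
  rw [(autEmbedding_isClosedEmbedding F').isInducing.continuous_iff, continuous_pi_iff]
  intro X
  have hco : (fun σ : Aut F => autEmbedding F' (e.conjAut σ) X) =
      fun σ => (e.app X).conjAut (autEmbedding F σ X) := by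
    funext σ
    refine Iso.ext ?_
    simp [Iso.conj_apply, autEmbedding_apply]
  rw [show (autEmbedding F' ∘ e.conjAut) = fun σ => autEmbedding F' (e.conjAut σ) from rfl]
  change Continuous fun σ : Aut F => autEmbedding F' (e.conjAut σ) X
  rw [hco]
  exact continuous_of_discreteTopology.comp
    ((continuous_apply X).comp (autEmbedding_isClosedEmbedding F).continuous)

/-- `Aut.autMulEquivOfIso` is `Iso.conjAut`. [folklore] -/
private theorem autMulEquivOfIso_eq_conjAut' {C : Type*} [Category C] {F G : C ⥤ FintypeCat.{v₁}}
    (h : F ≅ G) (x : Aut F) : Aut.autMulEquivOfIso h x = h.conjAut x :=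
  Iso.ext (by rw [Iso.conjAut_hom, Iso.conj_apply]; rfl)

/-- The normal core of a subgroup of finite index `n` has index dividing `n!`. [folklore] -/
private theorem index_normalCore_dvd_factorial' {G : Type*} [Group G] (H : Subgroup G)
    [H.FiniteIndex] : H.normalCore.index ∣ Nat.factorial H.index := by
  classical
  haveI : Finite (G ⧸ H) := Subgroup.finite_quotient_of_finiteIndex
  rw [Subgroup.normalCore_eq_ker, Subgroup.index_ker, Subgroup.index, ← Nat.card_perm]
  exact Subgroup.card_subgroup_dvd_card _

variable {Sigma : Set ℕ}

/-- A product of `Σ`-integers is a `Σ`-integer. [cite: MochizukiSemiAnbd2006, Def. 2.9(i) p.31] -/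
private theorem isSigmaInteger_prod {ι : Type*} (s : Finset ι) (f : ι → ℕ)
    (h : ∀ i ∈ s, IsSigmaInteger Sigma (f i)) : IsSigmaInteger Sigma (∏ i ∈ s, f i) := by
  classical
  induction s using Finset.induction_on with
  | empty => simpa using IsSigmaInteger.one Sigma
  | insert a s ha ih =>
    rw [Finset.prod_insert ha]
    exact (h a (Finset.mem_insert_self a s)).mul
      (ih fun i hi => h i (Finset.mem_insert_of_mem hi))

/-- **A closed subgroup of a pro-`Σ` completion is pro-`Σ`**: if `ψ : Q → P` is a continuous
injective homomorphism from a compact group into a pro-`Σ` completion `ι : Γ → P`, every open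
subgroup of `Q` has `Σ`-integer index (its image contains `Q ∩ U` for some open normal `U ⊴ P`).
[cite: MochizukiSemiAnbd2006, Ex. 2.10 p.31] -/
theorem isSigmaInteger_index_of_embedding {Γ : Type*} [Group Γ] {P : Type*} [Group P]
    [TopologicalSpace P] [IsTopologicalGroup P] [CompactSpace P] [TotallyDisconnectedSpace P]
    [T2Space P] {ι : Γ →* P} (hι : SemiGraphOfAnabelioids.IsProSigmaCompletion Sigma ι)
    {Q : Type*} [Group Q] [TopologicalSpace Q] [CompactSpace Q] (ψ : Q →ₜ* P)
    (hψ : Function.Injective ψ) (V : Subgroup Q) (hV : IsOpen (V : Set Q)) :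
    IsSigmaInteger Sigma V.index := by
  have hemb : IsClosedEmbedding ψ := ψ.continuous.isClosedEmbedding hψ
  obtain ⟨O, hO, hOV⟩ := hemb.isInducing.isOpen_iff.1 hV
  have h1 : (1 : P) ∈ O := by
    have : (1 : Q) ∈ ψ ⁻¹' O := by rw [hOV]; exact V.one_mem
    simpa using this
  obtain ⟨U, hU⟩ := ProfiniteGrp.exist_openNormalSubgroup_sub_open_nhds_of_one hO h1
  have hle : (U : Subgroup P).comap ψ.toMonoidHom ≤ V := by
    intro x hx
    have hx' : x ∈ ψ ⁻¹' O := hU hx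
    rw [hOV] at hx'
    exact hx'
  haveI : (U : Subgroup P).Normal := U.isNormal'
  refine (hι.index_open U U.isNormal' U.isOpen').of_dvd ((Subgroup.index_dvd_of_le hle).trans ?_)
  rw [Subgroup.index_comap]
  exact Subgroup.relIndex_dvd_index_of_normal _ _

end Prelim

namespace SemiGraphOfAnabelioids

variable {𝒢 : SemiGraphOfAnabelioids.{v₁, u₁, u}} {Sigma : Set ℕ}

/-! ### The branch homomorphism `Π_e → Π_v` of a surface-type vertex is a closed embedding into a pro-`Σ` group -/

/-- For `𝒢` of injective type, the branch homomorphism `ψ = (α-conjugation) ∘ π₁(b^*) : Π_e → Π_v`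
is continuous and injective. [cite: MochizukiSemiAnbd2006, Def. 2.1 p.23] -/
theorem branchHom_continuous_injective (hinj : 𝒢.IsOfInjectiveType) {v : 𝒢.graph.Vertex}
    (F : 𝒢.V v ⥤ FintypeCat.{v₁}) [FiberFunctor F] (b : 𝒢.graph.Branch)
    (h : 𝒢.graph.abuts b = some v) (Fe : 𝒢.E (𝒢.graph.edgeOf b) ⥤ FintypeCat.{v₁}) [FiberFunctor Fe]
    (α : (𝒢.pull b v h).pullback ⋙ Fe ≅ F) :
    Continuous ((Aut.autMulEquivOfIso α).toMonoidHom.comp (pi1Map (𝒢.pull b v h).pullback Fe)) ∧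
      Function.Injective
        ((Aut.autMulEquivOfIso α).toMonoidHom.comp (pi1Map (𝒢.pull b v h).pullback Fe)) := by
  haveI : FiberFunctor ((𝒢.pull b v h).pullback ⋙ Fe) := fiberFunctor_comp_of_exact _ _
  refine ⟨?_, ?_⟩
  · have hc : Continuous (Aut.autMulEquivOfIso α : Aut ((𝒢.pull b v h).pullback ⋙ Fe) → Aut F) := by
      rw [show (Aut.autMulEquivOfIso α : Aut ((𝒢.pull b v h).pullback ⋙ Fe) → Aut F) = α.conjAut
        from funext (autMulEquivOfIso_eq_conjAut' α)]
      exact continuous_conjAut_of_iso' α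
    exact hc.comp (continuous_pi1Map' _ _)
  · exact (Aut.autMulEquivOfIso α).injective.comp (hinj.isPi1Mono b v h Fe)

/-! ### Quasi-coherence -/

/-- **[SemiAnbd] Ex. 2.10 (1), quasi-coherence**: a semi-graph of anabelioids of surface type in
which every edge abuts to a vertex is quasi-coherent. [cite: MochizukiSemiAnbd2006, Ex. 2.10 p.31] -/
theorem isQuasiCoherent_of_isOfSurfaceType (hE : 𝒢.EveryEdgeAbuts) (hS : 𝒢.IsOfSurfaceType Sigma) :
    𝒢.IsQuasiCoherent := by
  classical
  refine ⟨hS.isOfInjectiveType, fun M hM 𝒞 => ?_⟩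
  haveI := 𝒞.fiberV
  haveI := 𝒞.fiberE
  -- (a) the uniform exponent `n`
  let S : Finset ℕ := (Finset.range (Nat.factorial M + 1)).filter (IsSigmaInteger Sigma)
  let n : ℕ := ∏ k ∈ S, k
  have hn : IsSigmaInteger Sigma n :=
    isSigmaInteger_prod S id fun k hk => (Finset.mem_filter.1 hk).2
  have hdvdn : ∀ k, IsSigmaInteger Sigma k → k ≤ Nat.factorial M → k ∣ n := fun k hk hkM =>
    Finset.dvd_prod_of_mem _ (Finset.mem_filter.2 ⟨Finset.mem_range.2 (Nat.lt_succ_of_le hkM), hk⟩)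
  -- (b) vertices: normal cores and the uniform cusp-order subgroups
  have hfinV : ∀ v, (𝒞.UV v).FiniteIndex := fun v =>
    @Subgroup.finiteIndex_of_finite_quotient _ _ _
      ((𝒞.UV v).quotient_finite_of_isOpen (𝒞.isOpen_UV v))
  have hcoreVo : ∀ v, IsOpen ((𝒞.UV v).normalCore : Set (Aut (𝒞.FV v))) := fun v => by
    haveI := hfinV v
    exact Subgroup.isOpen_of_isClosed_of_finiteIndex _
      (Subgroup.normalCore_isClosed _ (Subgroup.isClosed_of_isOpen _ (𝒞.isOpen_UV v)))
  have hcoreVidx : ∀ v, (𝒞.UV v).normalCore.index ∣ Nat.factorial M := fun v => by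
    haveI := hfinV v
    exact (index_normalCore_dvd_factorial' (𝒞.UV v)).trans
      (Nat.factorial_dvd_factorial (𝒞.index_UV v))
  have hpowV : ∀ (v : 𝒢.graph.Vertex) (x : Aut (𝒞.FV v)), x ^ n ∈ (𝒞.UV v).normalCore := by
    intro v x
    obtain ⟨g, r, ι, hh, hι, -⟩ := hS.vertex v (𝒞.FV v)
    have hSg : IsSigmaInteger Sigma (𝒞.UV v).normalCore.index :=
      hι.isSigmaInteger_index _ (hcoreVo v)
    have hle : (𝒞.UV v).normalCore.index ≤ Nat.factorial M :=
      Nat.le_of_dvd (Nat.factorial_pos M) (hcoreVidx v)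
    rw [← QuotientGroup.eq_one_iff, QuotientGroup.mk_pow]
    exact orderOf_dvd_iff_pow_eq_one.1 ((orderOf_dvd_natCard _).trans (hdvdn _ hSg hle))
  choose W hWo hWn hWle hWidx hWB using fun v =>
    hS.exists_open_normal_inter_branchSubgroup v (𝒞.FV v) hn (𝒞.UV v).normalCore (hcoreVo v)
      (hpowV v)
  -- (c) edges: the closed normal subgroup generated by the `n`-th powers
  let N : ∀ e : 𝒢.graph.Edge, Subgroup (Aut (𝒞.FE e)) := fun e =>
    (Subgroup.normalClosure ((fun x : Aut (𝒞.FE e) => x ^ n) '' Set.univ)).topologicalClosure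
  have hNn : ∀ e, (N e).Normal := fun e => Subgroup.is_normal_topologicalClosure _
  -- compatibility along every abutting branch
  have hcompat : ∀ (b : 𝒢.graph.Branch) (v : 𝒢.graph.Vertex) (h : 𝒢.graph.abuts b = some v),
      ∃ α : (𝒢.pull b v h).pullback ⋙ 𝒞.FE (𝒢.graph.edgeOf b) ≅ 𝒞.FV v,
        N (𝒢.graph.edgeOf b) = (W v).comap ((Aut.autMulEquivOfIso α).toMonoidHom.comp
          (pi1Map (𝒢.pull b v h).pullback (𝒞.FE (𝒢.graph.edgeOf b)))) := by
    intro b v h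
    obtain ⟨α, hα⟩ := hWB v ⟨b, h⟩ (𝒞.FE (𝒢.graph.edgeOf b))
    refine ⟨α, ?_⟩
    set ψ := (Aut.autMulEquivOfIso α).toMonoidHom.comp
      (pi1Map (𝒢.pull b v h).pullback (𝒞.FE (𝒢.graph.edgeOf b))) with hψ
    obtain ⟨hψc, hψi⟩ := branchHom_continuous_injective hS.isOfInjectiveType (𝒞.FV v) b h
      (𝒞.FE (𝒢.graph.edgeOf b)) α
    have hemb : IsClosedEmbedding ψ := hψc.isClosedEmbedding hψi
    haveI := hWn v
    -- the branch subgroup is the range of `ψ`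
    have hB : (𝒢.branchSubgroup (𝒞.FV v) b h (𝒞.FE (𝒢.graph.edgeOf b)) α : Set (Aut (𝒞.FV v))) =
        Set.range ψ := by
      rw [hψ]; exact (MonoidHom.coe_range _)
    -- `ψ⁻¹(W) = closure of the n-th powers`, as sets
    have hset : ((W v).comap ψ : Set (Aut (𝒞.FE (𝒢.graph.edgeOf b)))) =
        closure ((fun x : Aut (𝒞.FE (𝒢.graph.edgeOf b)) => x ^ n) '' Set.univ) := by
      have himg : (fun x : Aut (𝒞.FV v) => x ^ n) '' Set.range ψ =
          ψ '' ((fun x : Aut (𝒞.FE (𝒢.graph.edgeOf b)) => x ^ n) '' Set.univ) := by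
        ext y
        constructor
        · rintro ⟨_, ⟨x, rfl⟩, rfl⟩; exact ⟨x ^ n, ⟨x, Set.mem_univ _, rfl⟩, map_pow ψ x n⟩
        · rintro ⟨_, ⟨x, -, rfl⟩, rfl⟩; exact ⟨ψ x, ⟨x, rfl⟩, (map_pow ψ x n).symm⟩
      ext x
      rw [Subgroup.coe_comap, Set.mem_preimage, SetLike.mem_coe]
      constructor
      · intro hx
        have hx' : ψ x ∈ (W v : Set _) ∩ (𝒢.branchSubgroup (𝒞.FV v) b h _ α : Set _) :=
          ⟨hx, by rw [hB]; exact ⟨x, rfl⟩⟩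
        rw [hα, hB, himg, hemb.closure_image_eq] at hx'
        obtain ⟨x', hx', hxx'⟩ := hx'
        rwa [← hψi hxx']
      · intro hx
        have : ψ x ∈ closure ((fun y : Aut (𝒞.FV v) => y ^ n) ''
            (𝒢.branchSubgroup (𝒞.FV v) b h _ α : Set _)) := by
          rw [hB, himg, hemb.closure_image_eq]
          exact ⟨x, hx, rfl⟩
        rw [← hα] at this
        exact this.1
    apply le_antisymm
    · refine Subgroup.topologicalClosure_minimal _ (Subgroup.normalClosure_le_normal ?_) ?_
      · intro y hy
        rw [SetLike.mem_coe, ← SetLike.mem_coe, hset]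
        exact subset_closure hy
      · rw [hset]; exact isClosed_closure
    · intro x hx
      rw [← SetLike.mem_coe, hset] at hx
      exact closure_mono (Subgroup.subset_normalClosure) hx |> fun h' => by
        rw [← Subgroup.topologicalClosure_coe] at h'; exact h'
  -- openness of the `N_e`: through a branch (every edge abuts)
  have hNo : ∀ e, IsOpen (N e : Set (Aut (𝒞.FE e))) := by
    intro e
    obtain ⟨b, v, hbe, h⟩ := hE e
    subst hbe
    obtain ⟨α, hN⟩ := hcompat b v h
    obtain ⟨hψc, -⟩ := branchHom_continuous_injective hS.isOfInjectiveType (𝒞.FV v) b h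
      (𝒞.FE (𝒢.graph.edgeOf b)) α
    rw [hN, Subgroup.coe_comap]
    exact (hWo v).preimage hψc
  -- (d) the quotient approximator
  have hM' : 1 ≤ Nat.factorial M * n ^ 3 :=
    Nat.one_le_iff_ne_zero.2 (Nat.mul_ne_zero (Nat.factorial_pos M).ne' (pow_ne_zero 3 hn.1.ne'))
  obtain ⟨𝒢', φ, happ, hkerV, hkerE, -⟩ := 𝒢.exists_quotientApproximator_of_compat 𝒞.FV W hWo
    hWn 𝒞.FE N hNo hNn hcompat (Nat.factorial M * n ^ 3) hM'
    (fun v => (hWidx v).trans (Nat.mul_dvd_mul_right (hcoreVidx v) _))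
  refine ⟨𝒢', φ, happ.isApproximator, fun v => ?_, fun e => ?_⟩
  · rw [hkerV]
    exact (hWle v).trans (Subgroup.normalCore_le _)
  · rw [hkerE]
    -- `N_e ⊆ core(U_e) ⊆ U_e`: `Π_e` is pro-`Σ`, so `x ^ n ∈ core(U_e)` for all `x`
    obtain ⟨b, v, hbe, h⟩ := hE e
    subst hbe
    obtain ⟨g, r, ι, hh, hι, -⟩ := hS.vertex v (𝒞.FV v)
    obtain ⟨α, -⟩ := hcompat b v h
    obtain ⟨hψc, hψi⟩ := branchHom_continuous_injective hS.isOfInjectiveType (𝒞.FV v) b h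
      (𝒞.FE (𝒢.graph.edgeOf b)) α
    set e := 𝒢.graph.edgeOf b
    have hfinE : (𝒞.UE e).FiniteIndex :=
      @Subgroup.finiteIndex_of_finite_quotient _ _ _
        ((𝒞.UE e).quotient_finite_of_isOpen (𝒞.isOpen_UE e))
    have hcoreEo : IsOpen ((𝒞.UE e).normalCore : Set (Aut (𝒞.FE e))) :=
      Subgroup.isOpen_of_isClosed_of_finiteIndex _
        (Subgroup.normalCore_isClosed _ (Subgroup.isClosed_of_isOpen _ (𝒞.isOpen_UE e)))
    have hSg : IsSigmaInteger Sigma (𝒞.UE e).normalCore.index :=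
      isSigmaInteger_index_of_embedding hι ⟨_, hψc⟩ hψi _ hcoreEo
    have hle : (𝒞.UE e).normalCore.index ≤ Nat.factorial M :=
      Nat.le_of_dvd (Nat.factorial_pos M) ((index_normalCore_dvd_factorial' (𝒞.UE e)).trans
        (Nat.factorial_dvd_factorial (𝒞.index_UE e)))
    have hpow : ∀ x : Aut (𝒞.FE e), x ^ n ∈ (𝒞.UE e).normalCore := fun x => by
      rw [← QuotientGroup.eq_one_iff, QuotientGroup.mk_pow]
      exact orderOf_dvd_iff_pow_eq_one.1 ((orderOf_dvd_natCard _).trans (hdvdn _ hSg hle))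
    refine le_trans ?_ (Subgroup.normalCore_le (𝒞.UE e))
    refine Subgroup.topologicalClosure_minimal _ (Subgroup.normalClosure_le_normal ?_)
      (Subgroup.isClosed_of_isOpen _ hcoreEo)
    rintro _ ⟨x, -, rfl⟩
    exact hpow x

/-! ### Topological finite generation of the edge groups, and coherence -/

/-- **The `Π_e`-clause of coherence at an edge abutting to a surface-type vertex**: `Π_e ≅ Π_b =
(ι⟨c_j⟩)⁻` (a closed embedding onto a procyclic group) is topologically generated by the element over
`ι(c_j)`. [cite: MochizukiSemiAnbd2006, Ex. 2.10 p.31] -/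
theorem IsOfSurfaceType.isTopologicallyFinitelyGenerated_piE (hE : 𝒢.EveryEdgeAbuts)
    (hS : 𝒢.IsOfSurfaceType Sigma) (e : 𝒢.graph.Edge) (F : 𝒢.E e ⥤ FintypeCat.{v₁}) [FiberFunctor F] :
    AbsoluteAnabelian.IsTopologicallyFinitelyGenerated (Aut F) := by
  classical
  obtain ⟨b, v, hbe, h⟩ := hE e
  subst hbe
  haveI : FiberFunctor ((𝒢.pull b v h).pullback ⋙ F) := fiberFunctor_comp_of_exact _ _
  obtain ⟨g, r, ι, hh, hι, js, -, hbr⟩ := hS.vertex v ((𝒢.pull b v h).pullback ⋙ F)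
  obtain ⟨α, hα⟩ := hbr ⟨b, h⟩ F
  set ψ := (Aut.autMulEquivOfIso α).toMonoidHom.comp (pi1Map (𝒢.pull b v h).pullback F) with hψ
  obtain ⟨hψc, hψi⟩ := branchHom_continuous_injective hS.isOfInjectiveType
    ((𝒢.pull b v h).pullback ⋙ F) b h F α
  have hemb : IsClosedEmbedding ψ := hψc.isClosedEmbedding hψi
  have hB : (𝒢.branchSubgroup ((𝒢.pull b v h).pullback ⋙ F) b h F α : Set _) = Set.range ψ := by
    rw [hψ]; exact (MonoidHom.coe_range _)
  -- the element of `Π_e` over `ι(c_j)`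
  have hc : ι (PuncturedSurfaceGroup.c (js ⟨b, h⟩)) ∈ Set.range ψ := by
    rw [← hB, hα]
    exact subset_closure ⟨_, Subgroup.mem_zpowers _, rfl⟩
  obtain ⟨x, hx⟩ := hc
  refine ⟨⟨{x}, ?_⟩⟩
  rw [Finset.coe_singleton, ← Subgroup.zpowers_eq_closure]
  -- every `y ∈ Π_e` lies in the closure of `⟨x⟩`: its image lies in `(ι⟨c_j⟩)⁻ = (ψ⟨x⟩)⁻ = ψ(⟨x⟩⁻)`
  rw [eq_top_iff]
  intro y _
  have hy : ψ y ∈ closure (ι '' ((PuncturedSurfaceGroup.cuspInertia (g := g) (js ⟨b, h⟩) :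
      Subgroup (PuncturedSurfaceGroup g r)) : Set (PuncturedSurfaceGroup g r))) := by
    rw [← hα, hB]; exact ⟨y, rfl⟩
  have himg : ι '' ((PuncturedSurfaceGroup.cuspInertia (g := g) (js ⟨b, h⟩) :
      Subgroup (PuncturedSurfaceGroup g r)) : Set (PuncturedSurfaceGroup g r)) =
      ψ '' ((Subgroup.zpowers x : Subgroup (Aut F)) : Set (Aut F)) := by
    rw [PuncturedSurfaceGroup.cuspInertia, ← Subgroup.coe_map, MonoidHom.map_zpowers,
      ← Subgroup.coe_map, MonoidHom.map_zpowers, hx]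
  rw [himg, hemb.closure_image_eq] at hy
  obtain ⟨y', hy', hyy'⟩ := hy
  rw [← hψi hyy']
  rw [← Subgroup.topologicalClosure_coe] at hy'
  exact hy'

/-- **[SemiAnbd] Ex. 2.10 (1)**: a semi-graph of anabelioids of surface type in which every edge
abuts to a vertex is COHERENT (quasi-coherent, with all `Π_v`, `Π_e` topologically finitely
generated). [cite: MochizukiSemiAnbd2006, Ex. 2.10 p.31] -/
theorem isCoherent_of_isOfSurfaceType (hE : 𝒢.EveryEdgeAbuts) (hS : 𝒢.IsOfSurfaceType Sigma) :
    𝒢.IsCoherent :=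
  ⟨isQuasiCoherent_of_isOfSurfaceType hE hS, fun v F _ => hS.isTopologicallyFinitelyGenerated_piV v F,
    fun e F _ => hS.isTopologicallyFinitelyGenerated_piE hE e F⟩

/-- **[SemiAnbd] Ex. 2.10, conjunct (1) of the named fact `example_2_10`** (with the binder
`EveryEdgeAbuts` of ruling σ2), PROVED: for every semi-graph of anabelioids of surface type in
which every edge abuts to a vertex, `𝒢` is coherent. [cite: MochizukiSemiAnbd2006, Ex. 2.10 p.31] -/
theorem example_2_10_coherent_of :
    ∀ (𝒢 : SemiGraphOfAnabelioids.{v₁, u₁, u}) (Sigma : Set ℕ), 𝒢.EveryEdgeAbuts →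
      𝒢.IsOfSurfaceType Sigma → 𝒢.IsCoherent :=
  fun _ _ hE hS => isCoherent_of_isOfSurfaceType hE hS

end SemiGraphOfAnabelioids

end Literature.AnabelianGeometry.SemiGraphs
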